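import Summits.BirchSwinnertonDyer.BirchSwinnertonDyer.Theorems.ClassRecordThreeCornerAtThreeShimuraSwapFamilySupply
import Summits.BirchSwinnertonDyer.BirchSwinnertonDyer.Theorems.ClassRecordThreeEulerHalvesAtThreeLevelSupplyB6DOfPoitouTate
import Summits.BirchSwinnertonDyer.BirchSwinnertonDyer.Theorems.ClassRecordThreeEulerHalvesAtThreeKolyvaginFamilyTildeSign
import Summits.BirchSwinnertonDyer.BirchSwinnertonDyer.Theorems.ClassRecordThreeEulerHalvesAtThreeKolyvaginFamilyRootClass
import Summits.BirchSwinnertonDyer.BirchSwinnertonDyer.Theorems.ClassRecordThreeEulerHalvesAtThreeKolyvaginFamilyInvariance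
import Summits.BirchSwinnertonDyer.BirchSwinnertonDyer.Theorems.ClassRecordThreeEulerHalvesAtThreeKolyvaginFamilyStanding
import Summits.BirchSwinnertonDyer.BirchSwinnertonDyer.Theorems.ClassRecordThreeEulerHalvesAtThreeWalkSupplyTransverse
import Summits.BirchSwinnertonDyer.BirchSwinnertonDyer.Theorems.ClassRecordThreeCornerAtThreeShimuraFamilyTransverse
import Summits.BirchSwinnertonDyer.BirchSwinnertonDyer.Theorems.ClassRecordThreeCornerAtThreeShimuraFamilyProducers
import Summits.BirchSwinnertonDyer.BirchSwinnertonDyer.Theorems.ClassRecordThreeCornerAtThreeShimuraFamilyProducersLocal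
import Summits.BirchSwinnertonDyer.BirchSwinnertonDyer.Theorems.ClassRecordThreeCornerAtThreeShimuraFamilyH47Orders
import Summits.BirchSwinnertonDyer.BirchSwinnertonDyer.Theorems.ClassRecordThreeCornerAtThreeShimuraWalkB6DDefs
import Summits.BirchSwinnertonDyer.BirchSwinnertonDyer.Theorems.Rank1ResidualJetSelmerLemmas
import Summits.BirchSwinnertonDyer.BirchSwinnertonDyer.Theorems.Rank1ResidualJetRingClassFields
import Literature.NumberTheory.EllipticCurves.BSDSelmerCMPConverseHeegnerFieldProofs
import HarnessLib

/-!
# PORT TARGET 1 ON THE B6D FRAME, CLOSED MODULO POITOU–TATE: `(∀ K, PT K) → ShimuraWalk.SwapSupplyAtThreeB6D`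
# (cell `bsd-stepL`, seat `bsd-stepL-corner3-p2` g9 = WIDTH-LEVER lane B, owner of 21420's line `Cruxes/CornerAtThreeW/Lines/inert.lean`;
# `--supports stmt-BirchSwinnertonDyer-21420 --as helper`; the B6D frame is shared with crux 19109 `EulerHalvesAtThree`)

WHAT. `ShimuraWalk.swapSupplyAtThreeB6D_of_poitouTate`: Kolyvagin's PRIME SWAP (McCallum 1991 Prop. 5.2, Gross depth (3.2)) for the
labelled CM family `ys` of `X_{N⁺,N⁻}` at `p = 3 ∈ S` (inert in `K`), on the B6D frame (`NumberField.discr K < -4`), from Poitou–Tate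
duality for the tree's Selmer structures ALONE — i.e. conjunct 2 of r8's `stub_upper3_residualMulti` (21420) = 19109 r9's
`stub_swapSupplyAtThree`, VERBATIM its body `(∀ K, poitouTate_selmerStructure_duality_conj K) → ShimuraWalk.SwapSupplyAtThreeB6D`.

HOW (an ASSEMBLY of tree theorems; no definition, no named fact, no `sorry`). corner-p1 g15's (P1) swap layer
`Swap.shimuraWalk_swapSupplyAt_of_family` (p607230: bricks Tilde ∕ Prime ∕ Step ∕ LevelRaising ∕ Supply over corner3-p2 g8's END GLUE
`swapSupplyAt_of_familySwapSupply`) displays the family DICTIONARY {`hbot`, `hB4`, `hceb`, `hA`, `hP`, `hsign`, `hsel`, `h44`} for EVERY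
presentation `d` with `d.y = ys m`; every item is DISCHARGED here on the Shimura B6D frame from `LabelsAt` ∧ `LabelB6`:
* `hbot` (`E(K)[3] = 0`): `torsionBy_eq_bot_of_isImaginaryQuadratic_of_hasIrreducibleModPGaloisRep` (`E[3]` irreducible);
* `hB4` (weak (B4)): read off conjunct (B4) of `LabelsAt` (as tam3-p1's p605065);
* `hceb` (Gross-currency Čebotarev at INERT `3`): corner-p1's `Koly.hceb_family_three_of_mem_inertSet` (p602294, UNCONDITIONAL on this
  frame over corner3-p2's image inputs `kolyvaginImageInputs_three_of_mem_inertSet`);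
* `hA` (admissibility of `E(K[m]) ⊆ E(K̄)` at every `3^j`): tam3-p1's `KolyvaginFamilyData.isAdmissible_pointsSubgroup_family_of_hasIrreducibleModPGaloisRep`
  (p603099; `E[3]` irreducible, Weil pairing, `3` unramified in `K` since `3 ∈ S`, `3 ∤ m`);
* `hP` (invariance of `[P_m]` mod `3^{1+u}`): tam3-p1's `Koly.familyInvariance_of_labelsAt` (p604825, from (B4) of `LabelsAt`);
* `hsign` (Gross 5.4, CLASS form at level `3^{1+u}`): lane B g8's POINT-level `pointsMap_derivedPoint_familyData_of_labelsAt` (p605208, from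
  (B3)+(B4)) turned into the class statement by tam3-p1's `Koly.conjAct_kolyvaginClass_root_eq_smul_family` (root `Q := P_m`, `u := 0`) and
  corner-p1's `KolyvaginFamilyData.kolyvaginClass_eq_cocycleClass`;
* `hsel` (the level-`3` ROOT classes lie in `H_{𝓕(m)}` for the global intrinsic transverse family `𝒯`) — the ONE vocabulary bridge:
  bsd-jet's `mem_selmerGroup_selmerF_iff` splits it into (i) the Kummer condition at every place not over a prime of `m` = tam3-p1's
  `Koly.familyRootKummer_of_selmerLocalKer` (p606391's companion) fed by lane B g8's Gross 6.2 (1) producer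
  `kolyvaginClass_familyData_mem_selmerLocalKer_of_labelsAt` (p605614, from (B4)+(B6)) and `hP`, and (ii) `𝒯` at the places dividing `m` =
  lane B g8's Howard 2.7.3 producer `rootClass_familyData_mem_transverseKer` (p603631, ROOT form, `d_K < −4`) through tam3-p1's
  reconciliation `JET.Walk.globalTransverse_mem_iff` of the global family with the global rendering `transverseKer`;
* `h44` (McCallum Prop. 4.4 for ANY two presentations at `m ∣ mℓ`, order form at `λ ∣ ℓ`, level `3^{1+u}`): lane B g8's
  `addOrderOf_localization_kolyvaginClass_familyData_eq_of_labels_of_admissible` (p605268; coherent key relation (B4)+(B5) + transverse +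
  choice-freeness), modulo `1+u ↔ u+1`.
`d_K ∉ {−3, −4}` from `d_K < −4`; `[∀ j, NumberField K[j]]` from `JET.numberField_ringClassField`.

HONEST FRAMING: ONE conditional theorem; its only displayed input is the named Literature fact `poitouTate_selmerStructure_duality_conj`
(Poitou–Tate for Selmer structures, conjugation form — DERIVED in both inert lines from Milne I 4.10(b) `⊇` for THE canonical maps by
`Koly.poitouTate_conj_forall_of_selmerComplement_canonical`). `SwapSupplyAtThreeB6D` is thereby a kernel theorem MODULO `hPT`; the stub's conjunct 2
is closable BY NAME in the next line revision; conjunct 1 (`PrimitivesWithB6DAtThree`: print + (B6)) and the IMC tail remain. No item closes; no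
census label moves (T7); BSD is not proved by any of this. Credit: corner-p1 g9–g15 ((P1) layer), tam3-p1 g12–g14 (family datum, standing inputs,
root Kummer bridge, reconciliation), bsd-jet pv-2 (Selmer vocabulary), lane B g7–g8 (targets, glue, producers).

References (locators only): [cite: McCallumLMS1991, §5 Prop. 5.2 and proof (pp. 304–306), §4 Prop. 4.4, §3 Cor. 3.2] [cite: GrossLMS1991, §3 (3.2),
Prop. 3.6, Prop. 3.7, Prop. 5.4, §6 Prop. 6.2 (1)] [cite: Jetchev2008, §3.1.2, §3.4.1, Lemma 5.1] [cite: Howard2004HeegnerKolyvagin, Lemma 2.7.3]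
[cite: MilneADT2006, Ch. I, Thm. 4.10(b)] [cite: GrossZagier1986, III (3.1)] [cite: Kim2022HigherGZ, Rem. 7.9].
presearch: not applicable (assembly of tree theorems). Axioms: `propext`, `Classical.choice`, `Quot.sound`.
-/

set_option autoImplicit false
set_option linter.dupNamespace false

noncomputable section

open scoped Classical NumberField Pointwise

namespace Summit.BirchSwinnertonDyer.BirchSwinnertonDyer.Theorems.ShimuraWalk

open WeierstrassCurve IsDedekindDomain NumberField Field Function Literature.NumberTheory.EllipticCurves
  Literature.NumberTheory.EllipticCurves.ModularForms Literature.NumberTheory.EllipticCurves.Jetchev2008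
  Literature.NumberTheory.EllipticCurves.KolyvaginCocycle
  Literature.NumberTheory.EllipticCurves.Rank1Residual Literature.NumberTheory.GaloisRepresentations
  Literature.NumberTheory.GaloisCohomology Literature.NumberTheory.Automorphic
  Summit.BirchSwinnertonDyer.Rank1Residual.JET Summit.BirchSwinnertonDyer.Rank1Residual.JET.SelmerVocabulary
  Summit.BirchSwinnertonDyer.Rank1Residual.JET.Walk Summit.BirchSwinnertonDyer.Rank1Residual.JET.GlobalDuality
  Summit.BirchSwinnertonDyer.Rank1Residual.X11b Summit.BirchSwinnertonDyer.Rank1Residual.X11b.Three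
  Summit.BirchSwinnertonDyer.BirchSwinnertonDyer.Theorems
  Literature.NumberTheory.EllipticCurves.ShimuraCMFamily

set_option maxHeartbeats 800000 in
/-- **`(∀ K, PT K) → ShimuraWalk.SwapSupplyAtThreeB6D`** — Kolyvagin's prime swap (McCallum Prop. 5.2, Gross depth) for the labelled CM family of
`X_{N⁺,N⁻}` at `3 ∈ S` on the restricted frame `d_K < −4`, from Poitou–Tate duality for Selmer structures alone: corner-p1 g15's (P1) layer
`Swap.shimuraWalk_swapSupplyAt_of_family` with its dictionary {`hbot`, `hB4`, `hceb`, `hA`, `hP`, `hsign`, `hsel`, `h44`} discharged from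
`LabelsAt` ∧ `LabelB6` by lane B g8's ∀-datum producers, tam3-p1's standing inputs ∕ root Kummer bridge ∕ reconciliation, and corner-p1's
Čebotarev at inert `3`. The body of conjunct 2 of r8's `stub_upper3_residualMulti` (21420) = 19109 r9's `stub_swapSupplyAtThree`, VERBATIM.
[cite: McCallumLMS1991, §5 Prop. 5.2, §4 Prop. 4.4, §3 Cor. 3.2] [cite: GrossLMS1991, §3 (3.2), Prop. 5.4, §6 Prop. 6.2 (1)]
[cite: Jetchev2008, §3.1.2, §3.4.1, Lemma 5.1] [cite: Howard2004HeegnerKolyvagin, Lemma 2.7.3] [cite: MilneADT2006, Ch. I, Thm. 4.10(b)] -/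
theorem swapSupplyAtThreeB6D_of_poitouTate
    (hPT : ∀ (K : Type) [Field K] [NumberField K], poitouTate_selmerStructure_duality_conj K) :
    SwapSupplyAtThreeB6D := by
  intro W _ _ N _ K _ _ S Dt X W' _ P₀ hN hirr hK hD _hS hin hsp h3S _hc _hmin ι y ys ε hL hB6
  subst hN
  haveI : ∀ j : ℕ, NumberField (ringClassField K ι j) := numberField_ringClassField K hK ι
  have hp : (3 : ℕ).Prime := Fact.out
  have hp2 : (3 : ℕ) ≠ 2 := by decide
  have hD3 : NumberField.discr K ≠ -3 := by omega
  have hD4 : NumberField.discr K ≠ -4 := by omega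
  -- `E(K)[3] = 0` (`E[3]` irreducible)
  have hbot : AddSubgroup.torsionBy (W.baseChange K).toAffine.Point ((3 : ℕ) : ℤ) = ⊥ :=
    torsionBy_eq_bot_of_isImaginaryQuadratic_of_hasIrreducibleModPGaloisRep W K hK hp hirr
  -- `3` is unramified in `K` (`3 ∈ S`), the Weil pairing; admissibility of `E(K[n])` for every datum (`E[3]` irreducible)
  have hKunr := ShimuraKolyvaginOfImage.isUnramifiedIn_rat_of_not_dvd_discr K hp (hin 3 h3S).2.2.2.2
  have hW3 := WeierstrassCurve.exists_weilPairing_holds W 3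
  have hA : ∀ (n : ℕ) (d : KolyvaginFamilyData W K ι n), d.y = ys n → Squarefree n →
      (∀ q' ∈ n.primeFactors, IsKolyvaginPrime (W.conductorNorm ℤ) W K 3 q') →
      ∀ j : ℕ, IsAdmissible (absoluteGaloisGroup K) d.pointsSubgroup ((3 ^ j : ℕ) : ℤ) :=
    fun n d _ hn hKP j ↦ d.isAdmissible_pointsSubgroup_family_of_hasIrreducibleModPGaloisRep hK hn.ne_zero hp hp2
      hirr hW3 hKunr (fun h3n ↦ (hKP 3 (Nat.mem_primeFactors.mpr ⟨hp, h3n, hn.ne_zero⟩)).2.2.2.1 rfl) j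
  -- invariance of `[P_n]` mod `3^j`, `1 ≤ j ≤ M(n)`, for every datum (tam3-p1's p604825, from (B4) of `LabelsAt`)
  have hP := Koly.familyInvariance_of_labelsAt W hK ι hp Dt ys hL
  -- Gross 6.2 (1) for every datum at the finite places off `n` (lane B g8's `hSel`, from (B4)+(B6))
  have hSel : ∀ (M n : ℕ) (d : KolyvaginFamilyData W K ι n), 1 ≤ M → d.y = ys n → Squarefree n →
      (∀ q ∈ n.primeFactors, IsKolyvaginPrime (W.conductorNorm ℤ) W K 3 q ∧ FrobEqFrobInfty W K (3 ^ M) q) →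
      ∀ 𝔳 : HeightOneSpectrum (𝓞 K), (n : 𝓞 K) ∉ 𝔳.asIdeal →
        d.kolyvaginClass (Fact.out : (3 : ℕ).Prime) M ∈
          selmerLocalKer (W.baseChange K) (𝔳.adicCompletion K) ((3 ^ M : ℕ) : ℤ) :=
    fun M n d hM hdy hn hKol 𝔳 h𝔳 ↦
      kolyvaginClass_familyData_mem_selmerLocalKer_of_labelsAt hK ι rfl Dt hirr hin hsp ys hL hB6 hA M n d hM hdy hn hKol 𝔳 h𝔳
  -- the Gross level index from `Frob = Frob_∞` on `K(E[3^j])` at every prime of `n`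
  have hidx : ∀ {n : ℕ} (j : ℕ), (∀ q ∈ n.primeFactors, IsKolyvaginPrime (W.conductorNorm ℤ) W K 3 q ∧
      FrobEqFrobInfty W K (3 ^ j) q) → ((j : ℕ) : ℕ∞) ≤ frobLevelIndex W K 3 n :=
    fun j hKol ↦ (natCast_le_frobLevelIndex_iff (fun q hq ↦ (hKol q hq).1) j).mpr fun q hq ↦ (hKol q hq).2
  -- the (P1) swap layer with the dictionary discharged
  refine Swap.shimuraWalk_swapSupplyAt_of_family W hPT hK hD3 hD4 3 hp2 ι Dt ys hbot ?_ ?_ ?_ ?_ hL.1 ?_ ?_ ?_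
  · -- `hB4` read off (B4) of `LabelsAt`
    intro k hk hKP ℓ hℓ σ hσ
    have hle : ringClassField K ι (k / ℓ) ≤ ringClassField K ι k :=
      ringClassField_mono hK ι (Nat.div_dvd_of_dvd (Nat.dvd_of_mem_primeFactors hℓ)) hk.ne_zero
    exact ⟨_, hL.2.2.2.2.1 k hk (fun q' hq' ↦ ⟨(hKP q' hq').2.1, (hKP q' hq').2.2.2.2.1⟩) ℓ hℓ hle σ hσ⟩
  · -- `hceb`: Čebotarev in Gross's currency at INERT `3` (corner-p1 p602294 over lane B's image inputs)
    exact Koly.hceb_family_three_of_mem_inertSet W S rfl hirr hK hin hsp h3S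
  · -- `hA`
    intro u m dm hdy hm hKol
    exact hA m dm hdy hm (fun q hq ↦ (hKol q hq).1) (1 + u)
  · -- `hP`
    intro u m dm hdy hm hKol
    have hKol' : ∀ q ∈ m.primeFactors, IsKolyvaginPrime (W.conductorNorm ℤ) W K 3 q ∧ FrobEqFrobInfty W K (3 ^ (1 + u)) q :=
      fun q hq ↦ ⟨(hKol q hq).1, by rw [Nat.add_comm]; exact (hKol q hq).2⟩
    exact hP m dm hdy hm (fun q hq ↦ (hKol q hq).1) (1 + u) (Nat.le_add_right 1 u) (hidx (1 + u) hKol')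
  · -- `hsign`: Gross 5.4 in CLASS form at level `3^{1+u}` (point-level sign p605208 ⟹ class, root `Q := P_m`, `u := 0`)
    intro τ hτ u m dm hdy hm hKol
    have hKP : ∀ q ∈ m.primeFactors, IsKolyvaginPrime (W.conductorNorm ℤ) W K 3 q := fun q hq ↦ (hKol q hq).1
    have hKol' : ∀ q ∈ m.primeFactors, IsKolyvaginPrime (W.conductorNorm ℤ) W K 3 q ∧ FrobEqFrobInfty W K (3 ^ (1 + u)) q :=
      fun q hq ↦ ⟨hKP q hq, by rw [Nat.add_comm]; exact (hKol q hq).2⟩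
    have hA' : IsAdmissible (absoluteGaloisGroup K) dm.pointsSubgroup ((3 ^ (1 + u) : ℕ) : ℤ) := hA m dm hdy hm hKP (1 + u)
    have hP' : dm.toGeomPoints dm.derivedPoint ∈ invPoints (absoluteGaloisGroup K) dm.pointsSubgroup ((3 ^ (1 + u) : ℕ) : ℤ) :=
      hP m dm hdy hm hKP (1 + u) (Nat.le_add_right 1 u) (hidx (1 + u) hKol')
    have hcong := pointsMap_derivedPoint_familyData_of_labelsAt hK ι Dt hp ys hL hA hτ (isLiftOfAut_liftAut τ) m dm hdy hm
      hKP (1 + u) (Nat.le_add_right 1 u) (hidx (1 + u) hKol')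
    rw [dm.kolyvaginClass_eq_cocycleClass (Fact.out : (3 : ℕ).Prime) (1 + u) hA' hP']
    exact Koly.conjAct_kolyvaginClass_root_eq_smul_family dm hp (k := 1 + u) (u := 0) hA' (isLiftOfAut_liftAut τ)
      (dm.pointsMap_mem_pointsSubgroup_family hK hm.ne_zero (isLiftOfAut_liftAut τ)) _ hcong dm.derivedPoint
      (by rw [pow_zero, Nat.cast_one, one_smul]) hA' hP'
  · -- `hsel`: the level-`3` root classes lie in `H_{𝓕(m)}` for the global intrinsic transverse family (the vocabulary bridge)
    intro 𝒯 h𝒯 u m dm hdy hm hKol Q hA1 hQ hQP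
    have hKP : ∀ q ∈ m.primeFactors, IsKolyvaginPrime (W.conductorNorm ℤ) W K 3 q := fun q hq ↦ (hKol q hq).1
    have huk : ((u + 1 : ℕ) : ℕ∞) ≤ frobLevelIndex W K 3 m := hidx (u + 1) hKol
    refine (mem_selmerGroup_selmerF_iff W _ 𝒯 hm.ne_zero _).mpr ⟨?_, ?_⟩
    · -- Kummer condition at every place not over a prime of `m` (Gross 6.2 (1) for `c_{1+u}(m)`, pulled back to the root class)
      exact Koly.familyRootKummer_of_selmerLocalKer W hK ι 3 ys hA hP hSel 1 m dm le_rfl hdy hm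
        (fun q hq ↦ ⟨hKP q hq, (hKol q hq).2.of_dvd (pow_dvd_pow 3 (Nat.le_add_left 1 u))⟩) u Q hA1 hQ hQP huk
    · -- the transverse condition at the places dividing `m` (Howard 2.7.3, ROOT form; reconciliation with `transverseKer`)
      exact (globalTransverse_mem_iff h𝒯 hm _).mpr fun ℓ hℓ ↦
        rootClass_familyData_mem_transverseKer W hK hD hp2 ι 1 hm hKP dm u Q hA1 hQ hQP huk hℓ
  · -- `h44`: McCallum Prop. 4.4 for ANY two presentations at `m ∣ mℓ`, order form, level `3^{1+u}` (lane B g8 p605268)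
    intro u m l hml hl hlm hKol dm dml hdy hdly v hv
    have hm : Squarefree m := hml.squarefree_of_dvd (dvd_mul_right m l)
    have hKol' : ∀ q ∈ (m * l).primeFactors, IsKolyvaginPrime (W.conductorNorm ℤ) W K 3 q ∧
        FrobEqFrobInfty W K (3 ^ (1 + u)) q :=
      fun q hq ↦ ⟨(hKol q hq).1, by rw [Nat.add_comm]; exact (hKol q hq).2⟩
    exact addOrderOf_localization_kolyvaginClass_familyData_eq_of_labels_of_admissible hK hD ι rfl hp2 Dt ys hL hA
      (1 + u) m (m * l) dm dml l (Nat.le_add_right 1 u) hdy hdly hm hKol' hl hlm rfl v hv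

end Summit.BirchSwinnertonDyer.BirchSwinnertonDyer.Theorems.ShimuraWalk

end
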